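import Summits.NavierStokesRegularity.NavierStokesRegularity.Theorems.HodographBetchovFastClassSqueezeStreamStrainRegularity
import Summits.NavierStokesRegularity.NavierStokesRegularity.Theorems.HodographBetchovEquivalence
import Summits.NavierStokesRegularity.NavierStokesRegularity.Theorems.NoBlowupToClay

/-!
# Crux `HodographBetchov.FastClassSqueeze` — the STREAM-STRAIN SQUEEZE: one fast-class statement
# equivalent to Clay (A), implying both open cruxes

Helper file for the crux item stmt-NavierStokesRegularity-15832 (`FastClassSqueeze`; it serves
stmt-NavierStokesRegularity-15831, `SlowClassProduction`, equally). The STREAM-STRAIN SQUEEZE is the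
statement: along every classical solution of unforced Navier–Stokes on `ℝ³ × [0, T)` that is
Leray–Hopf from a rapidly decaying datum there are `l > 0`, `r > 3/2` and `m ≥ 0` majorising the
stream-directional strain on the fast class, `‖S(t,x) u(t,x)‖ ≤ m(t,x) ‖u(t,x)‖` for `l < ‖u(t,x)‖`,
with `∫₀ᵀ (∫_{l<‖u(t)‖} m^r)^{2/(2r−3)} < ∞` — Miller's class on the fast class for `‖S û‖`,
`û = u/|u|`, a quantity between the crux's `λ₂⁺(S)` (`|λ₂| ≤ ‖S û‖`, `Directional`) and the
`birth` line's `‖∇u‖`.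

* `noBlowup_of_streamStrainSqueeze`, `navierStokesRegularity_of_streamStrainSqueeze` — the squeeze
  gives Clay (A) WITHOUT any slow-class hypothesis (`hasSmoothExtensionPast_of_streamStrainSqueeze`,
  the velocity-truncated enstrophy ledger, + `navierStokesRegularity_of_noBlowup`);
* `streamStrainSqueeze_of_navierStokesRegularity` — necessity (no blow-up ⇒ bounded ⇒ empty fast
  class), hence `navierStokesRegularity_iff_streamStrainSqueeze`;
* `fastClassSqueeze_of_streamStrainSqueeze`, `slowClassProduction_of_streamStrainSqueeze` — the
  squeeze implies BOTH open cruxes of the route (through Clay (A) and the necessity theorems of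
  `…Equivalence.lean`).

So the route's decomposition `SlowClassProduction ∧ FastClassSqueeze` can be traded for the single
fast-class statement: the slow-class crux is an artefact of the sharp class and of the `λ₂⁺`
majorant — with the stream-directional strain on the fast class the slow class takes care of
itself (its production is integrated by parts against the bounded velocity and absorbed).

References: E. Miller, Arch. Ration. Mech. Anal. 235 (2020), Thm. 1.1 / Thm. 1.3; H. Beirão da
Veiga, Chinese Ann. Math. Ser. B 16 (1995); T. Tao, Anal. PDE 6 (2013).
-/

noncomputable section

open MeasureTheory Set Function Filter Topology InnerProductSpace
open scoped ENNReal NNReal ContDiff RealInnerProductSpace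

-- the summit and its single sub-problem share the name (CONVENTIONS §1), as in every Theorems file
set_option linter.dupNamespace false

namespace Summit.NavierStokesRegularity.NavierStokesRegularity.Theorems.FastClassSqueeze.StreamStrain

open Literature.Analysis Literature.Analysis.FluidPDE
open Summit.NavierStokesRegularity.NavierStokesRegularity.Theses.HodographBetchov

/-- **The stream-strain squeeze rules out blow-up** (per-solution theorem
`hasSmoothExtensionPast_of_streamStrainSqueeze` under the `∀`-solution hypothesis). [cite: Miller2019, Thm 1.1] -/
theorem noBlowup_of_streamStrainSqueeze
    (h : ∀ (ν T : ℝ), 0 < ν → 0 < T →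
      ∀ (u : ℝ → EuclideanSpace ℝ (Fin 3) → EuclideanSpace ℝ (Fin 3))
        (p : ℝ → EuclideanSpace ℝ (Fin 3) → ℝ),
        IsClassicalNSSolutionOn (Set.Ico 0 T) ν 0 u p → IsLerayHopfOn T ν 0 (u 0) u →
        HasRapidSpatialDecay (u 0) →
        ∃ l : ℝ, 0 < l ∧ ∃ r : ℝ, 3 / 2 < r ∧ ∃ m : ℝ → EuclideanSpace ℝ (Fin 3) → ℝ,
          (∀ t x, 0 ≤ m t x) ∧
          (∀ t ∈ Set.Ioo 0 T, ∀ x, l < ‖u t x‖ →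
            ‖((1 / 2 : ℝ) • (fderiv ℝ (u t) x + ContinuousLinearMap.adjoint (fderiv ℝ (u t) x)))
              (u t x)‖ ≤ m t x * ‖u t x‖) ∧
          ∫⁻ t in Set.Ioo 0 T, (∫⁻ x in {x : EuclideanSpace ℝ (Fin 3) | l < ‖u t x‖},
            ENNReal.ofReal (m t x) ^ r) ^ (2 / (2 * r - 3)) < ⊤) :
    ∀ (ν T : ℝ), 0 < ν → 0 < T →
      ∀ (u : ℝ → EuclideanSpace ℝ (Fin 3) → EuclideanSpace ℝ (Fin 3))
        (p : ℝ → EuclideanSpace ℝ (Fin 3) → ℝ),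
        IsClassicalNSSolutionOn (Set.Ico 0 T) ν 0 u p → IsLerayHopfOn T ν 0 (u 0) u →
        HasRapidSpatialDecay (u 0) → HasSmoothExtensionPast ν 0 u T := by
  intro ν T hν hT u p hcl hLH hdec
  obtain ⟨l, hl, r, hr, m, hm0, hdir, hΛ⟩ := h ν T hν hT u p hcl hLH hdec
  exact hasSmoothExtensionPast_of_streamStrainSqueeze hν hT hcl hLH hdec hl hr hm0 hdir hΛ

/-- **The stream-strain squeeze gives Clay (A)** — WITHOUT a slow-class hypothesis
(`noBlowup_of_streamStrainSqueeze` + the tree's `navierStokesRegularity_of_noBlowup`). [cite: Miller2019, Thm 1.1] -/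
theorem navierStokesRegularity_of_streamStrainSqueeze
    (h : ∀ (ν T : ℝ), 0 < ν → 0 < T →
      ∀ (u : ℝ → EuclideanSpace ℝ (Fin 3) → EuclideanSpace ℝ (Fin 3))
        (p : ℝ → EuclideanSpace ℝ (Fin 3) → ℝ),
        IsClassicalNSSolutionOn (Set.Ico 0 T) ν 0 u p → IsLerayHopfOn T ν 0 (u 0) u →
        HasRapidSpatialDecay (u 0) →
        ∃ l : ℝ, 0 < l ∧ ∃ r : ℝ, 3 / 2 < r ∧ ∃ m : ℝ → EuclideanSpace ℝ (Fin 3) → ℝ,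
          (∀ t x, 0 ≤ m t x) ∧
          (∀ t ∈ Set.Ioo 0 T, ∀ x, l < ‖u t x‖ →
            ‖((1 / 2 : ℝ) • (fderiv ℝ (u t) x + ContinuousLinearMap.adjoint (fderiv ℝ (u t) x)))
              (u t x)‖ ≤ m t x * ‖u t x‖) ∧
          ∫⁻ t in Set.Ioo 0 T, (∫⁻ x in {x : EuclideanSpace ℝ (Fin 3) | l < ‖u t x‖},
            ENNReal.ofReal (m t x) ^ r) ^ (2 / (2 * r - 3)) < ⊤) :
    _root_.NavierStokesRegularity :=
  navierStokesRegularity_of_noBlowup (noBlowup_of_streamStrainSqueeze h)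

/-- **Necessity: Clay (A) ⇒ the stream-strain squeeze.** Under (A) a classical Leray–Hopf solution
from a rapidly decaying datum extends past `T` (`HodographBetchov.noBlowup_of_navierStokesRegularity`),
so it is bounded on `[0, T) × ℝ³` (`FastClassSqueeze.bounded_of_hasSmoothExtensionPast`) and its
fast class above the bound is empty: `m = 0` serves. [folklore] -/
theorem streamStrainSqueeze_of_navierStokesRegularity (hA : _root_.NavierStokesRegularity) :
    ∀ (ν T : ℝ), 0 < ν → 0 < T →
      ∀ (u : ℝ → EuclideanSpace ℝ (Fin 3) → EuclideanSpace ℝ (Fin 3))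
        (p : ℝ → EuclideanSpace ℝ (Fin 3) → ℝ),
        IsClassicalNSSolutionOn (Set.Ico 0 T) ν 0 u p → IsLerayHopfOn T ν 0 (u 0) u →
        HasRapidSpatialDecay (u 0) →
        ∃ l : ℝ, 0 < l ∧ ∃ r : ℝ, 3 / 2 < r ∧ ∃ m : ℝ → EuclideanSpace ℝ (Fin 3) → ℝ,
          (∀ t x, 0 ≤ m t x) ∧
          (∀ t ∈ Set.Ioo 0 T, ∀ x, l < ‖u t x‖ →
            ‖((1 / 2 : ℝ) • (fderiv ℝ (u t) x + ContinuousLinearMap.adjoint (fderiv ℝ (u t) x)))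
              (u t x)‖ ≤ m t x * ‖u t x‖) ∧
          ∫⁻ t in Set.Ioo 0 T, (∫⁻ x in {x : EuclideanSpace ℝ (Fin 3) | l < ‖u t x‖},
            ENNReal.ofReal (m t x) ^ r) ^ (2 / (2 * r - 3)) < ⊤ := by
  intro ν T hν hT u p hcl hLH hdec
  obtain ⟨M, hM⟩ := FastClassSqueeze.bounded_of_hasSmoothExtensionPast ν T hν hT u p hcl hLH hdec
    (HodographBetchov.noBlowup_of_navierStokesRegularity hA ν T hν hT u p hcl hLH hdec)
  refine ⟨max M 0 + 1, by positivity, 2, by norm_num, fun _ _ => 0, fun _ _ => le_rfl, ?_, ?_⟩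
  · intro t ht x hx
    exact absurd ((hM t ⟨ht.1.le, ht.2⟩ x).trans ((le_max_left M 0).trans (lt_add_one _).le))
      (not_le.2 hx)
  · have hzero : ∀ t, (∫⁻ x in {x : EuclideanSpace ℝ (Fin 3) | max M 0 + 1 < ‖u t x‖},
        ENNReal.ofReal (0 : ℝ) ^ (2 : ℝ)) ^ (2 / (2 * (2 : ℝ) - 3)) = 0 := by
      intro t
      rw [ENNReal.ofReal_zero, ENNReal.zero_rpow_of_pos two_pos, lintegral_zero,
        ENNReal.zero_rpow_of_pos (by norm_num)]
    simp_rw [hzero, lintegral_zero]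
    exact ENNReal.zero_lt_top

/-- **EQUIVALENCE: the stream-strain squeeze IS the Millennium statement** — a single FAST-CLASS
statement (no slow-class budget), sitting between the crux `FastClassSqueeze` and the `birth` line's
fast-gradient squeeze. The registered helper stub of this file. [cite: Miller2019, Thm 1.1] -/
theorem navierStokesRegularity_iff_streamStrainSqueeze :
    _root_.NavierStokesRegularity ↔
    (∀ (ν T : ℝ), 0 < ν → 0 < T →
      ∀ (u : ℝ → EuclideanSpace ℝ (Fin 3) → EuclideanSpace ℝ (Fin 3))
        (p : ℝ → EuclideanSpace ℝ (Fin 3) → ℝ),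
        Literature.Analysis.FluidPDE.IsClassicalNSSolutionOn (Set.Ico 0 T) ν 0 u p →
        Literature.Analysis.FluidPDE.IsLerayHopfOn T ν 0 (u 0) u →
        Literature.Analysis.FluidPDE.HasRapidSpatialDecay (u 0) →
        ∃ l : ℝ, 0 < l ∧ ∃ r : ℝ, 3 / 2 < r ∧ ∃ m : ℝ → EuclideanSpace ℝ (Fin 3) → ℝ,
          (∀ t x, 0 ≤ m t x) ∧
          (∀ t ∈ Set.Ioo 0 T, ∀ x, l < ‖u t x‖ →
            ‖((1 / 2 : ℝ) • (fderiv ℝ (u t) x + ContinuousLinearMap.adjoint (fderiv ℝ (u t) x)))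
              (u t x)‖ ≤ m t x * ‖u t x‖) ∧
          ∫⁻ t in Set.Ioo 0 T, (∫⁻ x in {x : EuclideanSpace ℝ (Fin 3) | l < ‖u t x‖},
            ENNReal.ofReal (m t x) ^ r) ^ (2 / (2 * r - 3)) < ⊤) :=
  ⟨streamStrainSqueeze_of_navierStokesRegularity, navierStokesRegularity_of_streamStrainSqueeze⟩

/-- **The stream-strain squeeze implies crux `FastClassSqueeze`** (through Clay (A) and the
necessity theorem `HodographBetchov.fastClassSqueeze_of_navierStokesRegularity`; directly it is
also the directional transfer with `Ξ = û`). [cite: Miller2019, Thm 1.3] -/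
theorem fastClassSqueeze_of_streamStrainSqueeze
    (h : ∀ (ν T : ℝ), 0 < ν → 0 < T →
      ∀ (u : ℝ → EuclideanSpace ℝ (Fin 3) → EuclideanSpace ℝ (Fin 3))
        (p : ℝ → EuclideanSpace ℝ (Fin 3) → ℝ),
        IsClassicalNSSolutionOn (Set.Ico 0 T) ν 0 u p → IsLerayHopfOn T ν 0 (u 0) u →
        HasRapidSpatialDecay (u 0) →
        ∃ l : ℝ, 0 < l ∧ ∃ r : ℝ, 3 / 2 < r ∧ ∃ m : ℝ → EuclideanSpace ℝ (Fin 3) → ℝ,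
          (∀ t x, 0 ≤ m t x) ∧
          (∀ t ∈ Set.Ioo 0 T, ∀ x, l < ‖u t x‖ →
            ‖((1 / 2 : ℝ) • (fderiv ℝ (u t) x + ContinuousLinearMap.adjoint (fderiv ℝ (u t) x)))
              (u t x)‖ ≤ m t x * ‖u t x‖) ∧
          ∫⁻ t in Set.Ioo 0 T, (∫⁻ x in {x : EuclideanSpace ℝ (Fin 3) | l < ‖u t x‖},
            ENNReal.ofReal (m t x) ^ r) ^ (2 / (2 * r - 3)) < ⊤) :
    FastClassSqueeze :=
  HodographBetchov.fastClassSqueeze_of_navierStokesRegularity (navierStokesRegularity_of_streamStrainSqueeze h)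

/-- **The stream-strain squeeze implies crux `SlowClassProduction`** (through Clay (A) and
`HodographBetchov.slowClassProduction_of_navierStokesRegularity`): the slow-class budget is a
CONSEQUENCE of the fast-class stream-strain squeeze, not an independent input. [folklore] -/
theorem slowClassProduction_of_streamStrainSqueeze
    (h : ∀ (ν T : ℝ), 0 < ν → 0 < T →
      ∀ (u : ℝ → EuclideanSpace ℝ (Fin 3) → EuclideanSpace ℝ (Fin 3))
        (p : ℝ → EuclideanSpace ℝ (Fin 3) → ℝ),
        IsClassicalNSSolutionOn (Set.Ico 0 T) ν 0 u p → IsLerayHopfOn T ν 0 (u 0) u →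
        HasRapidSpatialDecay (u 0) →
        ∃ l : ℝ, 0 < l ∧ ∃ r : ℝ, 3 / 2 < r ∧ ∃ m : ℝ → EuclideanSpace ℝ (Fin 3) → ℝ,
          (∀ t x, 0 ≤ m t x) ∧
          (∀ t ∈ Set.Ioo 0 T, ∀ x, l < ‖u t x‖ →
            ‖((1 / 2 : ℝ) • (fderiv ℝ (u t) x + ContinuousLinearMap.adjoint (fderiv ℝ (u t) x)))
              (u t x)‖ ≤ m t x * ‖u t x‖) ∧
          ∫⁻ t in Set.Ioo 0 T, (∫⁻ x in {x : EuclideanSpace ℝ (Fin 3) | l < ‖u t x‖},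
            ENNReal.ofReal (m t x) ^ r) ^ (2 / (2 * r - 3)) < ⊤) :
    SlowClassProduction :=
  HodographBetchov.slowClassProduction_of_navierStokesRegularity
    (navierStokesRegularity_of_streamStrainSqueeze h)

end Summit.NavierStokesRegularity.NavierStokesRegularity.Theorems.FastClassSqueeze.StreamStrain

end
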